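import Mathlib
import Summits.ValiantsHypothesis.ValiantsHypothesis.Theses.BarrierLever
import Summits.ValiantsHypothesis.ValiantsHypothesis.Theorems.BarrierLeverDefinableEquationsReduction

/-!
# Crux `BarrierLever.DefinableEquations` (stmt-ValiantsHypothesis-8745), line `registered` — the
# line's reduction transfers verbatim to the infinitely-often form of the crux (lead c5)

Companion to `Theorems/BarrierLeverDefinableEquationsInfinitelyOften.lean` (the assembly consumes
the crux only infinitely often in `n`: `valiantsHypothesis_of_succinct_of_io`).  The line's landed
reduction `DefinableEquations_of_polyShortTableauEquation` (H_poly → DefEq, level `a = 17c + 18`)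
is pointwise in `n`, so the infinitely-often form of the open stub H_poly already gives the
infinitely-often form `DefEq_io` of the crux, with the same level: if for some `c ≥ 1`, every size
exponent `b` and every threshold `n₀` there is `n ≥ n₀` at which a nonzero combination of `k ≤ N^c`
tableau contractions with `N^c`-bounded data vanishes on the image of Raz's map `Γ`
(`razPoint n b`), then for every `b, n₀` there is `n ≥ n₀` carrying a nonzero level-`(17c+18)`
boolean-sum equation against `SmallCircuits ℂ n b` (`io_of_polyShortTableauEquation_io`; proof =
the tree proof of `DefinableEquations_of_polyShortTableauEquation` run at one `n ≥ n₀ + 2`: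
`tableauSumsDefinable_pow`, `stub_razTopUniversality`, injectivity of `rename (topIncl n)`).
So a crux restated as `DefEq_io` keeps the line `registered` CLOSED MODULO {H_poly i.o.}.
No definitions, no facts.
-/

set_option linter.dupNamespace false

noncomputable section

namespace Summit.ValiantsHypothesis.ValiantsHypothesis.Theorems.BarrierLeverDefinableEquations

open MvPolynomial
open Literature.Computability.AlgebraicComplexity Literature.Barriers.ValiantsHypothesis
open scoped BigOperators

namespace InfinitelyOften

/-- **H_poly infinitely often ⇒ DefEq_io** (level `a = 17c + 18`): the reduction
`DefinableEquations_of_polyShortTableauEquation` run at a single `n ≥ n₀ + 2`. [folklore] -/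
theorem io_of_polyShortTableauEquation_io (c : ℕ) (hc : 1 ≤ c)
    (hH : ∀ b n₀ : ℕ, ∃ n : ℕ, n₀ ≤ n ∧ ∃ (k : ℕ) (τ : Fin k → TabDatum n) (a : Fin k → ℂ),
      ShortComb ((Nat.choose (2 * n) n) ^ c) τ ∧ combPoly τ a ≠ 0 ∧
        ∀ y : RazUniversal.Lab (Fin n) n (razSlots n b) → ℂ,
          eval (razPoint n b y) (combPoly τ a) = 0) :
    ∃ a : ℕ, ∀ b n₀ : ℕ, ∃ n : ℕ, n₀ ≤ n ∧ ∃ q : ℕ, q ≤ (Nat.choose (2 * n) n) ^ a ∧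
      ∃ H : MvPolynomial (↥(degLEMonomials n) ⊕ Fin q) ℂ,
        complexity H ≤ (Nat.choose (2 * n) n) ^ a ∧ H.totalDegree ≤ (Nat.choose (2 * n) n) ^ a ∧
        boolSum H ≠ 0 ∧
        ∀ f ∈ SmallCircuits ℂ n b, eval (coeffVector (degLEMonomials n) f) (boolSum H) = 0 := by
  refine ⟨17 * c + 18, fun b n₀ => ?_⟩
  obtain ⟨n, hn, k, τ, cf, hshort, hne, hvan⟩ := hH b (n₀ + 2)
  obtain ⟨q, hq, H, hHc, hHd, hsum⟩ := tableauSumsDefinable_pow c hc n (by omega) k τ cf hshort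
  refine ⟨n, by omega, q, hq, H, hHc, hHd, ?_, ?_⟩
  · rw [hsum]
    intro h0
    apply hne
    apply MvPolynomial.rename_injective _ (topIncl_injective n)
    rw [h0, map_zero]
  · intro f hf
    obtain ⟨y, hy⟩ := stub_razTopUniversality n b (by omega) f hf
    rw [hsum, MvPolynomial.eval_rename]
    have hpt : (coeffVector (degLEMonomials n) f ∘ topIncl n) = razPoint n b y := by
      funext e
      rw [Function.comp_apply, coeffVector_apply, hy e]
      rfl
    rw [hpt]
    exact hvan y

/-- The eventual form of H_poly (the registered stub's statement, for a fixed `c`) implies its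
infinitely-often form. [folklore] -/
theorem polyShortTableauEquation_io_of_eventually (c : ℕ)
    (hH : ∀ b : ℕ, ∃ n₀ : ℕ, ∀ n ≥ n₀, ∃ (k : ℕ) (τ : Fin k → TabDatum n) (a : Fin k → ℂ),
      ShortComb ((Nat.choose (2 * n) n) ^ c) τ ∧ combPoly τ a ≠ 0 ∧
        ∀ y : RazUniversal.Lab (Fin n) n (razSlots n b) → ℂ,
          eval (razPoint n b y) (combPoly τ a) = 0) :
    ∀ b n₀ : ℕ, ∃ n : ℕ, n₀ ≤ n ∧ ∃ (k : ℕ) (τ : Fin k → TabDatum n) (a : Fin k → ℂ),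
      ShortComb ((Nat.choose (2 * n) n) ^ c) τ ∧ combPoly τ a ≠ 0 ∧
        ∀ y : RazUniversal.Lab (Fin n) n (razSlots n b) → ℂ,
          eval (razPoint n b y) (combPoly τ a) = 0 := by
  intro b n₀
  obtain ⟨n₀', h⟩ := hH b
  exact ⟨max n₀ n₀', le_max_left _ _, h _ (le_max_right _ _)⟩

end InfinitelyOften

/-- **Registered sub-goal `io_of_polyShortTableauEquation_io` (verbatim signature).**  H_poly
infinitely often, for some `c ≥ 1`, gives the infinitely-often form of the crux
(`InfinitelyOften.io_of_polyShortTableauEquation_io`). [folklore] -/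
theorem io_of_polyShortTableauEquation_io :
    ∀ c : ℕ, 1 ≤ c → (∀ b n₀ : ℕ, ∃ n : ℕ, n₀ ≤ n ∧ ∃ (k : ℕ) (τ : Fin k → Summit.ValiantsHypothesis.ValiantsHypothesis.Theorems.BarrierLeverDefinableEquations.TabDatum n) (a : Fin k → ℂ), Summit.ValiantsHypothesis.ValiantsHypothesis.Theorems.BarrierLeverDefinableEquations.ShortComb ((Nat.choose (2 * n) n) ^ c) τ ∧ Summit.ValiantsHypothesis.ValiantsHypothesis.Theorems.BarrierLeverDefinableEquations.combPoly τ a ≠ 0 ∧ ∀ y : Literature.Computability.AlgebraicComplexity.RazUniversal.Lab (Fin n) n (Summit.ValiantsHypothesis.ValiantsHypothesis.Theorems.BarrierLeverDefinableEquations.razSlots n b) → ℂ, MvPolynomial.eval (Summit.ValiantsHypothesis.ValiantsHypothesis.Theorems.BarrierLeverDefinableEquations.razPoint n b y) (Summit.ValiantsHypothesis.ValiantsHypothesis.Theorems.BarrierLeverDefinableEquations.combPoly τ a) = 0) → ∃ a : ℕ, ∀ b n₀ : ℕ, ∃ n : ℕ, n₀ ≤ n ∧ ∃ q : ℕ, q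 ≤ (Nat.choose (2 * n) n) ^ a ∧ ∃ H : MvPolynomial (↥(Literature.Barriers.ValiantsHypothesis.degLEMonomials n) ⊕ Fin q) ℂ, Literature.Computability.AlgebraicComplexity.complexity H ≤ (Nat.choose (2 * n) n) ^ a ∧ H.totalDegree ≤ (Nat.choose (2 * n) n) ^ a ∧ Literature.Computability.AlgebraicComplexity.boolSum H ≠ 0 ∧ ∀ f ∈ Literature.Barriers.ValiantsHypothesis.SmallCircuits ℂ n b, MvPolynomial.eval (Literature.Barriers.ValiantsHypothesis.coeffVector (Literature.Barriers.ValiantsHypothesis.degLEMonomials n) f) (Literature.Computability.AlgebraicComplexity.boolSum H) = 0 :=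
  fun c hc hH => InfinitelyOften.io_of_polyShortTableauEquation_io c hc hH

end Summit.ValiantsHypothesis.ValiantsHypothesis.Theorems.BarrierLeverDefinableEquations

end
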